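import Mathlib
import Literature.AlgebraicGeometry.Resolution.CobordantGame
import Literature.AlgebraicGeometry.Resolution.CobordantChartCoefficients
import Literature.AlgebraicGeometry.Resolution.CobordantChartPlaneSlice
import Literature.AlgebraicGeometry.Resolution.CobordantTupleGame
import Literature.AlgebraicGeometry.Resolution.FormalCoordinateChange
import Summits.ResolutionOfSingularities.ResolutionOfSingularities.Theorems.WeightedInvariantGlobalizeLocalDropCanonize
import Summits.ResolutionOfSingularities.ResolutionOfSingularities.Theorems.WeightedInvariantGlobalizeLocalDropCylinder
import Summits.ResolutionOfSingularities.ResolutionOfSingularities.Theorems.WeightedInvariantLocalWeightedDropDoublePointLiftPlane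
import Summits.ResolutionOfSingularities.ResolutionOfSingularities.Theorems.WeightedInvariantLocalWeightedDropTschirnhausFormAux
import Summits.ResolutionOfSingularities.ResolutionOfSingularities.Theorems.WeightedInvariantLocalWeightedDropCriticalSection

/-!
# Helpers for the multiplicity lift — the transform of a prepared germ under the mirrored move

Crux `LocalWeightedDrop` (stmt-ResolutionOfSingularities-8899, route ResolutionOfSingularities/WeightedInvariant),
line `hasse-ridge-face-selection`, registered stub `stub_multiplicityLift` (file
`WeightedInvariantLocalWeightedDropMultiplicityLift`).  Notation: the prepared germ
`TupleGame.germ U a = U · y^{e+2} + Σ_j a_j(x') y^j` lives in `k[[x', y]]` (`y = X (Fin.last m)`); a tuple move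
`(Φ, w)` of the `x'`-variables is mirrored as `Θ = (Φ ⊗ id)` with weights `Wt = (w, W)`; after the weighted
chart at the exceptional point `pt` the variables are `s = X 0`, `y'_i = X (Fin.castSucc i).succ` and
`Y = X (Fin.last (m + 1))`.

* `transform_germ`, `transform_factor`: the transform is `s^{(e+2)W} · g₀`,
  `g₀ = U♯ (γ + Y)^{e+2} + Σ_j s^{D_j - m_j W} G_j♮ (γ + Y)^j` (`γ = pt_y` if `W > 0`, else `0`);
* `coeff_single_g₀`, `coeff_single_g₀_zero`: the pure `Y`-coefficients of `g₀` (read through the indicator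
  substitution `π = (Y ↦ Y, else ↦ 0)`, which kills `s`, the `y'` and, for `W > 0`, all of `U♯` but `U(0)`):
  `Y^{e+2} ↦ U(0)` (so `s ∤ g₀`), `Y^{e+1} ↦ (e+2) γ U(0)`, constant `↦ U(0) γ^{e+2}` off the old slots;
* `constantCoeff_eq_zero_of_factor_vertex`: at the vertex `c = 0` of the `x'`-chart every factor `G_j` has
  `G_j(0) = 0`;
* `coeff_germ`, `germ_order_lt` (registered sub-goal `stub_multiplicityLiftGermOrder` at the end of the file): the
  coefficients `x'^β y^j` (`j ≤ e`) of a prepared germ are those of its tuple, so a non-bad entry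
  (`ord a_j < marking e j = e + 2 - j`) forces `ord (germ U a) < e + 2`.

The slice/shape bookkeeping (`y'_{i₀} ↦ 0` of `g₀` at `γ = 0` is again a prepared germ) and the induction are in the
main file.
-/

set_option linter.dupNamespace false -- mandated namespace of this single-conjunct summit

namespace Summit.ResolutionOfSingularities.ResolutionOfSingularities.Theorems

open Literature.AlgebraicGeometry.Resolution
open Literature.AlgebraicGeometry.Resolution.CobordantGame

namespace MultiplicityLift

open MvPowerSeries

variable {k : Type} [Field k] {m : ℕ}

/-! ### The mirrored move `Θ = (Φ ⊗ id)`, weights `Wt = (w, W)`, and the transform of the germ -/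

section LiftMove

variable {Φ : Fin m → MvPowerSeries (Fin m) k} {W : ℕ} {w : Fin m → ℕ}
  {Θ : Fin (m + 1) → MvPowerSeries (Fin (m + 1)) k} {Wt : Fin (m + 1) → ℕ}
  (hΘ : Θ = Fin.insertNth (α := fun _ => MvPowerSeries (Fin (m + 1)) k) (Fin.last m) (X (Fin.last m))
    (fun i => rename (Fin.succAboveEmb (Fin.last m)) (Φ i)))
  (hWt : Wt = Fin.insertNth (α := fun _ => ℕ) (Fin.last m) W w)

include hWt in
/-- The old slots of the chart of `Wt = (w, W)` at `pt`: the chart of `w` at the projected point, renamed. -/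
theorem cruxChart_succAbove (pt : Fin (m + 1) → k) (i : Fin m) :
    cruxChart k Wt pt ((Fin.last m).succAbove i) =
      rename (Fin.succAboveEmb (Fin.last (m + 1))) (cruxChart k w (fun i => pt ((Fin.last m).succAbove i)) i) := by
  have hsc : (Fin.succAboveEmb (Fin.last (m + 1))) i.succ = ((Fin.last m).succAbove i).succ :=
    Fin.succ_succAbove_succ (Fin.last m) i
  rw [hWt]
  simp only [cruxChart, Fin.insertNth_apply_succAbove]
  split_ifs with hw
  · rw [map_mul, map_pow, map_add, rename_X, rename_C, rename_X, hsc,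
      show (Fin.succAboveEmb (Fin.last (m + 1))) (0 : Fin (m + 1)) = 0 from succAboveEmb_succ_zero (Fin.last m)]
  · rw [rename_X, hsc]

include hWt in
/-- The chart of `Wt` applied to a series in the old slots is the renamed chart of `w` at the projected point. -/
theorem subst_cruxChart_rename (pt : Fin (m + 1) → k) (H : MvPowerSeries (Fin m) k) :
    subst (cruxChart k Wt pt) (rename (Fin.succAboveEmb (Fin.last m)) H) =
      rename (Fin.succAboveEmb (Fin.last (m + 1)))
        (subst (cruxChart k w fun i => pt ((Fin.last m).succAbove i)) H) := by
  rw [subst_rename_eq _ _ (constantCoeff_cruxChart Wt pt) H,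
    rename_subst_eq _ _ (constantCoeff_cruxChart w _) H]
  congr 1
  funext i
  exact cruxChart_succAbove hWt pt i

include hWt in
/-- The distinguished slot of the chart of `Wt`: `y ↦ s^W (γ + Y)`, `γ = pt_y` if `W > 0` and `0` otherwise. -/
theorem cruxChart_last (pt : Fin (m + 1) → k) :
    cruxChart k Wt pt (Fin.last m) =
      X 0 ^ W * (C (if 0 < W then pt (Fin.last m) else 0) + X (Fin.last (m + 1))) := by
  rw [hWt]
  unfold cruxChart
  rw [Fin.insertNth_apply_same]
  split_ifs with hW
  · rfl
  · rw [show W = 0 by omega, pow_zero, one_mul, map_zero, zero_add]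
    rfl

include hΘ hWt in
/-- THE TRANSFORM OF THE PREPARED GERM under the mirrored move `Θ = (Φ ⊗ id)`, weights `Wt = (w, W)`, at the
exceptional point `pt`:
`U♯ · (s^W (γ + Y))^{e+2} + Σ_j (a_j ∘ Φ)(chart of w at the projected point)♮ · (s^W (γ + Y))^j`. -/
theorem transform_germ (hΦ0 : ∀ i, constantCoeff (Φ i) = 0) (pt : Fin (m + 1) → k) {e : ℕ}
    (U : MvPowerSeries (Fin (m + 1)) k) (a : Fin (e + 1) → MvPowerSeries (Fin m) k) :
    subst (cruxChart k Wt pt) (subst Θ (TupleGame.germ U a)) =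
      subst (cruxChart k Wt pt) (subst Θ U) *
          (X 0 ^ W * (C (if 0 < W then pt (Fin.last m) else 0) + X (Fin.last (m + 1)))) ^ (e + 2) +
        ∑ j : Fin (e + 1), rename (Fin.succAboveEmb (Fin.last (m + 1)))
            (subst (cruxChart k w fun i => pt ((Fin.last m).succAbove i)) (subst Φ (a j))) *
          (X 0 ^ W * (C (if 0 < W then pt (Fin.last m) else 0) + X (Fin.last (m + 1)))) ^ (j : ℕ) := by
  have hΘ0 : ∀ i, constantCoeff (Θ i) = 0 := hΘ ▸ constantCoeff_cylMove (Fin.last m) Φ hΦ0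
  have hΘs := hasSubst_of_constantCoeff_zero hΘ0
  have hs := hasSubst_of_constantCoeff_zero (constantCoeff_cruxChart (k := k) Wt pt)
  have hΘL : subst Θ (X (Fin.last m) : MvPowerSeries (Fin (m + 1)) k) = X (Fin.last m) := by
    rw [subst_X hΘs, hΘ, Fin.insertNth_apply_same]
  have hΘa : ∀ j, subst Θ (rename (Fin.succAboveEmb (Fin.last m)) (a j)) =
      rename (Fin.succAboveEmb (Fin.last m)) (subst Φ (a j)) := fun j => by
    rw [hΘ]
    exact subst_cylMove_rename (Fin.last m) Φ hΦ0 (a j)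
  unfold TupleGame.germ
  rw [← coe_substAlgHom hΘs, ← coe_substAlgHom hs]
  simp only [map_add, map_mul, map_pow, map_sum]
  simp only [coe_substAlgHom, hΘL, hΘa, subst_X hs, cruxChart_last hWt, subst_cruxChart_rename hWt]

end LiftMove

/-- THE `s`-ADIC FACTORISATION OF THE TRANSFORM (pure algebra): with `a_j-part = s^{D_j} G_j` and
`m_j W ≤ D_j` on the non-zero parts (`m_j = marking e j`, `m_j + j = e + 2`), the transform is
`s^{(e+2)W} · (V Q^{e+2} + Σ_j s^{D_j - m_j W} G_j Q^j)`. -/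
theorem transform_factor {R : Type} [CommRing R] {e W : ℕ} (s V Q : R) (B G : Fin (e + 1) → R)
    (D : Fin (e + 1) → ℕ) (hB : ∀ j, B j = s ^ D j * G j)
    (hD : ∀ j, G j = 0 ∨ TupleGame.marking e j * W ≤ D j) :
    V * (s ^ W * Q) ^ (e + 2) + ∑ j, B j * (s ^ W * Q) ^ (j : ℕ) =
      s ^ ((e + 2) * W) * (V * Q ^ (e + 2) + ∑ j, s ^ (D j - TupleGame.marking e j * W) * G j * Q ^ (j : ℕ)) := by
  rw [mul_add, Finset.mul_sum]
  congr 1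
  · ring
  · refine Finset.sum_congr rfl fun j _ => ?_
    rcases hD j with h0 | hle
    · simp [hB j, h0]
    · obtain ⟨r, hr⟩ := Nat.exists_eq_add_of_le hle
      rw [hB j, hr, Nat.add_sub_cancel_left,
        show (e + 2) * W = TupleGame.marking e j * W + (j : ℕ) * W by
          rw [← TupleGame.marking_add_val e j, add_mul]]
      ring

/-! ### Pure `Y`-coefficients of the `s`-saturated transform `g₀` -/

/-- Constants are `Y`-free. -/
theorem noY_C (c : k) :
    ∀ E : Fin (m + 1) →₀ ℕ, E (Fin.last m) ≠ 0 → coeff E (C c : MvPowerSeries (Fin (m + 1)) k) = 0 := by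
  classical
  intro E hE
  rw [coeff_C, if_neg]
  rintro rfl
  exact hE rfl

/-- BINOMIAL COEFFICIENTS: the `Y^q`-coefficient of `c · (γ + Y)^n` is `c · C(n, q) · γ^{n-q}`. -/
theorem coeff_single_C_mul_add_pow (c γ : k) (q n : ℕ) :
    coeff (Finsupp.single (Fin.last (m + 1)) q)
        (C c * (C γ + X (Fin.last (m + 1))) ^ n : MvPowerSeries (Fin (m + 1 + 1)) k) =
      c * (n.choose q : k) * γ ^ (n - q) := by
  have h := TschirnhausForm.coeff_add_single_mul_add_pow (m := m + 1) (noY_C c) (noY_C γ) (β := 0)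
    (Finsupp.zero_apply) q n
  rw [zero_add] at h
  rw [add_comm (C γ), h, ← map_pow, ← map_mul, coeff_zero_C]
  ring

section Proj

variable {π : Fin (m + 1 + 1) → MvPowerSeries (Fin (m + 1 + 1)) k}
  (hπ : ∀ l, π l = if l = Fin.last (m + 1) then X l else 0)

include hπ

/-- The indicator substitution `π = (Y ↦ Y, else ↦ 0)` sends a series in the old slots to its constant term. -/
theorem subst_proj_rename (H : MvPowerSeries (Fin (m + 1)) k) :
    subst π (rename (Fin.succAboveEmb (Fin.last (m + 1))) H) = C (constantCoeff H) := by
  classical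
  ext d
  rw [CriticalSection.coeff_subst_indSubst hπ, coeff_C]
  by_cases hd : d = 0
  · subst hd
    rw [if_pos (fun i hi => absurd hi (by simp)), if_pos rfl, coeff_zero_eq_constantCoeff_apply,
      constantCoeff_rename]
  · rw [if_neg hd]
    split_ifs with hall
    · apply DoublePointLift.coeff_rename_eq_zero
      obtain ⟨i, hi⟩ := Finsupp.support_nonempty_iff.mpr hd
      have h := hall i hi
      subst h
      exact Finsupp.mem_support_iff.mp hi
    · rfl

/-- `π` kills the exceptional variable `s = X 0`. -/
theorem subst_proj_X_zero : subst π (X 0 : MvPowerSeries (Fin (m + 1 + 1)) k) = 0 := by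
  rw [subst_X (CriticalSection.hasSubst_indSubst hπ), hπ, if_neg Fin.last_pos.ne]

/-- `π` fixes `Y`. -/
theorem subst_proj_X_last :
    subst π (X (Fin.last (m + 1)) : MvPowerSeries (Fin (m + 1 + 1)) k) = X (Fin.last (m + 1)) := by
  rw [subst_X (CriticalSection.hasSubst_indSubst hπ), hπ, if_pos rfl]

/-- For `W > 0` the chart of `Wt = (w, W)` followed by `π` kills everything but the constant term. -/
theorem subst_proj_subst_cruxChart {W : ℕ} {w : Fin m → ℕ} {Wt : Fin (m + 1) → ℕ}
    (hWt : Wt = Fin.insertNth (α := fun _ => ℕ) (Fin.last m) W w) (hW : 0 < W) (pt : Fin (m + 1) → k)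
    (F : MvPowerSeries (Fin (m + 1)) k) :
    subst π (subst (cruxChart k Wt pt) F) = C (constantCoeff F) := by
  have hπs : HasSubst π := CriticalSection.hasSubst_indSubst hπ
  have hs := hasSubst_of_constantCoeff_zero (constantCoeff_cruxChart (k := k) Wt pt)
  have hzero : (fun l => subst π (cruxChart k Wt pt l)) = 0 := by
    funext l
    rw [Pi.zero_apply]
    rcases Fin.eq_self_or_eq_succAbove (Fin.last m) l with rfl | ⟨i, rfl⟩
    · rw [cruxChart_last hWt, if_pos hW, subst_mul hπs, subst_pow hπs, subst_proj_X_zero hπ, zero_pow hW.ne',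
        zero_mul]
    · have hne : ((Fin.last m).succAbove i).succ ≠ Fin.last (m + 1) := by
        rw [Fin.succAbove_last_apply, Fin.succ_castSucc]
        exact (Fin.castSucc_lt_last _).ne
      rw [hWt]
      unfold cruxChart
      rw [Fin.insertNth_apply_succAbove]
      split_ifs with hw
      · rw [subst_mul hπs, subst_pow hπs, subst_proj_X_zero hπ, zero_pow hw.ne', zero_mul]
      · rw [subst_X hπs, hπ, if_neg hne]
  rw [subst_comp_subst_apply hs hπs, hzero, subst_zero_eq_C_constantCoeff]
  simp

/-- THE PURE `Y`-COEFFICIENTS OF `g₀ = V (γ + Y)^{e+2} + Σ_j s^{r_j} G_j♮ (γ + Y)^j` when `π V = V(0)`: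
`Y^q ↦ V(0) C(e+2, q) γ^{e+2-q} + Σ_j 0^{r_j} G_j(0) C(j, q) γ^{j-q}`. -/
theorem coeff_single_g₀ {V : MvPowerSeries (Fin (m + 1 + 1)) k} {u₀ : k} (hV : subst π V = C u₀) (γ : k) {e : ℕ}
    (G : Fin (e + 1) → MvPowerSeries (Fin (m + 1)) k) (r : Fin (e + 1) → ℕ) (q : ℕ) :
    coeff (Finsupp.single (Fin.last (m + 1)) q)
        (V * (C γ + X (Fin.last (m + 1))) ^ (e + 2) +
          ∑ j, X 0 ^ (r j) * rename (Fin.succAboveEmb (Fin.last (m + 1))) (G j) *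
            (C γ + X (Fin.last (m + 1))) ^ (j : ℕ)) =
      u₀ * ((e + 2).choose q : k) * γ ^ (e + 2 - q) +
        ∑ j : Fin (e + 1), (0 : k) ^ (r j) * constantCoeff (G j) * ((j : ℕ).choose q : k) * γ ^ ((j : ℕ) - q) := by
  have hπs : HasSubst π := CriticalSection.hasSubst_indSubst hπ
  have hkeep : ∀ i ∈ (Finsupp.single (Fin.last (m + 1)) q).support, i = Fin.last (m + 1) := fun i hi =>
    Finset.mem_singleton.mp (Finsupp.support_single_subset hi)
  rw [← CriticalSection.coeff_subst_indSubst_of_forall hπ _ hkeep, ← coe_substAlgHom hπs]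
  simp only [map_add, map_mul, map_pow, map_sum]
  simp only [coe_substAlgHom, hV, subst_C, subst_proj_X_zero hπ, subst_proj_X_last hπ, subst_proj_rename hπ]
  rw [coeff_single_C_mul_add_pow]
  congr 1
  refine Finset.sum_congr rfl fun j _ => ?_
  rw [show ((0 : MvPowerSeries (Fin (m + 1 + 1)) k) ^ (r j) * C (constantCoeff (G j))) =
      C ((0 : k) ^ (r j) * constantCoeff (G j)) by rw [map_mul, map_pow, map_zero], coeff_single_C_mul_add_pow]

/-- `s ∤ g₀`: the `Y^{e+2}`-coefficient of `g₀` is `V(0)` (case `π V = V(0)`, i.e. `W > 0`). -/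
theorem coeff_top_g₀ {V : MvPowerSeries (Fin (m + 1 + 1)) k} {u₀ : k} (hV : subst π V = C u₀) (γ : k) {e : ℕ}
    (G : Fin (e + 1) → MvPowerSeries (Fin (m + 1)) k) (r : Fin (e + 1) → ℕ) :
    coeff (Finsupp.single (Fin.last (m + 1)) (e + 2))
        (V * (C γ + X (Fin.last (m + 1))) ^ (e + 2) +
          ∑ j, X 0 ^ (r j) * rename (Fin.succAboveEmb (Fin.last (m + 1))) (G j) *
            (C γ + X (Fin.last (m + 1))) ^ (j : ℕ)) = u₀ := by
  rw [coeff_single_g₀ hπ hV, Finset.sum_eq_zero (fun j _ => by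
      rw [Nat.choose_eq_zero_of_lt (by have := j.isLt; omega), Nat.cast_zero, mul_zero, zero_mul]),
    add_zero, Nat.choose_self, Nat.cast_one, mul_one, Nat.sub_self, pow_zero, mul_one]

/-- THE ORDER DROP AT `γ ≠ 0`: the `Y^{e+1}`-coefficient of `g₀` is `(e + 2) γ V(0)` (case `π V = V(0)`). -/
theorem coeff_sub_g₀ {V : MvPowerSeries (Fin (m + 1 + 1)) k} {u₀ : k} (hV : subst π V = C u₀) (γ : k) {e : ℕ}
    (G : Fin (e + 1) → MvPowerSeries (Fin (m + 1)) k) (r : Fin (e + 1) → ℕ) :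
    coeff (Finsupp.single (Fin.last (m + 1)) (e + 1))
        (V * (C γ + X (Fin.last (m + 1))) ^ (e + 2) +
          ∑ j, X 0 ^ (r j) * rename (Fin.succAboveEmb (Fin.last (m + 1))) (G j) *
            (C γ + X (Fin.last (m + 1))) ^ (j : ℕ)) = u₀ * ((e + 2 : ℕ) : k) * γ := by
  rw [coeff_single_g₀ hπ hV, Finset.sum_eq_zero (fun j _ => by
      rw [Nat.choose_eq_zero_of_lt j.isLt, Nat.cast_zero, mul_zero, zero_mul]),
    add_zero, show (e + 2).choose (e + 1) = e + 2 from Nat.choose_succ_self_right (e + 1),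
    show e + 2 - (e + 1) = 1 by omega, pow_one]

/-- OFF THE OLD SLOTS NOTHING IS SINGULAR: if every `G_j(0) = 0` then `g₀(0) = V(0) γ^{e+2}` (case `π V = V(0)`). -/
theorem constantCoeff_g₀ {V : MvPowerSeries (Fin (m + 1 + 1)) k} {u₀ : k} (hV : subst π V = C u₀) (γ : k) {e : ℕ}
    {G : Fin (e + 1) → MvPowerSeries (Fin (m + 1)) k} (hG : ∀ j, constantCoeff (G j) = 0) (r : Fin (e + 1) → ℕ) :
    constantCoeff (V * (C γ + X (Fin.last (m + 1))) ^ (e + 2) +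
          ∑ j, X 0 ^ (r j) * rename (Fin.succAboveEmb (Fin.last (m + 1))) (G j) *
            (C γ + X (Fin.last (m + 1))) ^ (j : ℕ)) = u₀ * γ ^ (e + 2) := by
  rw [← coeff_zero_eq_constantCoeff_apply,
    show (0 : Fin (m + 1 + 1) →₀ ℕ) = Finsupp.single (Fin.last (m + 1)) 0 from (Finsupp.single_zero _).symm,
    coeff_single_g₀ hπ hV, Finset.sum_eq_zero (fun j _ => by rw [hG j, mul_zero, zero_mul, zero_mul]), add_zero,
    Nat.choose_zero_right, Nat.cast_one, mul_one, Nat.sub_zero]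

end Proj

/-- Coefficients of a renamed old-slot series vanish at exponents involving `Y` (restated). -/
theorem coeff_single_rename_eq_zero (H : MvPowerSeries (Fin (m + 1)) k) {t : ℕ} (ht : t ≠ 0) :
    coeff (Finsupp.single (Fin.last (m + 1)) t) (rename (Fin.succAboveEmb (Fin.last (m + 1))) H) = 0 :=
  DoublePointLift.coeff_rename_eq_zero H (by rwa [Finsupp.single_eq_same])

/-- THE `Y^{e+2}`-COEFFICIENT OF `g₀` AT `γ = 0` is `V(0)` (no hypothesis on `V`). -/
theorem coeff_single_g₀_zero (V : MvPowerSeries (Fin (m + 1 + 1)) k) {e : ℕ}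
    (G : Fin (e + 1) → MvPowerSeries (Fin (m + 1)) k) (r : Fin (e + 1) → ℕ) :
    coeff (Finsupp.single (Fin.last (m + 1)) (e + 2))
        (V * (C (0 : k) + X (Fin.last (m + 1))) ^ (e + 2) +
          ∑ j, X 0 ^ (r j) * rename (Fin.succAboveEmb (Fin.last (m + 1))) (G j) *
            (C (0 : k) + X (Fin.last (m + 1))) ^ (j : ℕ)) = constantCoeff V := by
  rw [map_zero, zero_add, map_add, map_sum, X_pow_eq, coeff_mul_monomial, if_pos le_rfl, tsub_self, mul_one,
    coeff_zero_eq_constantCoeff_apply, Finset.sum_eq_zero, add_zero]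
  intro j _
  have hj : (j : ℕ) ≤ e + 2 := by have := j.isLt; omega
  rw [X_pow_eq _ (j : ℕ), coeff_mul_monomial, if_pos (Finsupp.single_le_iff.mpr (by rwa [Finsupp.single_eq_same])),
    mul_one, ← Finsupp.single_tsub,
    show X 0 ^ (r j) * rename (Fin.succAboveEmb (Fin.last (m + 1))) (G j) =
      rename (Fin.succAboveEmb (Fin.last (m + 1))) (X 0 ^ (r j) * G j) by
        rw [map_mul, map_pow, rename_X,
          show (Fin.succAboveEmb (Fin.last (m + 1))) (0 : Fin (m + 1)) = 0 from succAboveEmb_succ_zero (Fin.last m)]]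
  exact coeff_single_rename_eq_zero _ (by omega)

/-! ### The factors `G_j` at the vertex of the old chart -/

/-- AT THE VERTEX `c = 0` of the chart `x_i ↦ s^{w_i}(c_i + y_i)` every `s`-saturated factor of a series without
constant term has zero constant term: `B(chart) = s^D · G ⟹ G(0) = 0`. -/
theorem constantCoeff_eq_zero_of_factor_vertex (w : Fin m → ℕ) {B : MvPowerSeries (Fin m) k}
    (hB0 : constantCoeff B = 0) {D : ℕ} {G : MvPowerSeries (Fin (m + 1)) k}
    (hfac : subst (CobordantChart.chart w 0) B = X 0 ^ D * G) : constantCoeff G = 0 := by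
  rw [← coeff_zero_eq_constantCoeff_apply, ← Finsupp.cons_zero_zero, CobordantChart.coeff_cons_of_eq_X_pow_mul hfac,
    add_zero, CobordantChart.coeff_cons_zero_subst_chart w 0 (fun _ _ => rfl) B D, CobordantChart.initEval]
  apply finsum_eq_zero_of_forall_eq_zero
  intro d
  split_ifs with hd
  · by_cases hd0 : d = 0
    · rw [hd0, coeff_zero_eq_constantCoeff_apply, hB0, zero_mul]
    · obtain ⟨i, hi⟩ := Finsupp.support_nonempty_iff.mpr hd0
      rw [Finset.prod_eq_zero (Finset.mem_univ i) (by
        rw [Pi.zero_apply, zero_pow (Finsupp.mem_support_iff.mp hi)]), mul_zero]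
  · rfl

/-! ### Coefficients and order of a prepared germ -/

/-- THE COEFFICIENTS OF A PREPARED GERM below `y^{e+1}`: `coeff (x'^β y^j) (germ U a) = coeff β (a j)`. -/
theorem coeff_germ {e : ℕ} (U : MvPowerSeries (Fin (m + 1)) k) (a : Fin (e + 1) → MvPowerSeries (Fin m) k)
    (β : Fin m →₀ ℕ) (j : Fin (e + 1)) :
    coeff (Finsupp.embDomain (Fin.succAboveEmb (Fin.last m)) β + Finsupp.single (Fin.last m) (j : ℕ))
      (TupleGame.germ U a) = coeff β (a j) := by
  have hj := j.isLt
  unfold TupleGame.germ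
  rw [map_add, map_sum, TschirnhausForm.coeff_emb_add_single_mul_X_pow, if_neg (by omega), zero_add,
    Finset.sum_eq_single j]
  · rw [TschirnhausForm.coeff_emb_add_single_mul_X_pow, if_pos le_rfl, Nat.sub_self,
      TschirnhausForm.coeff_emb_add_single_rename, if_pos rfl]
  · intro l _ hl
    rw [TschirnhausForm.coeff_emb_add_single_mul_X_pow]
    split_ifs with hle
    · rw [TschirnhausForm.coeff_emb_add_single_rename, if_neg]
      intro h
      exact hl (Fin.ext (by omega))
    · rfl
  · intro h
    exact absurd (Finset.mem_univ j) h

/-- A PREPARED GERM WITH A NON-BAD ENTRY HAS ORDER `< e + 2`: if `ord a_j < marking e j` then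
`ord (germ U a) < e + 2`. -/
theorem germ_order_lt {e : ℕ} (U : MvPowerSeries (Fin (m + 1)) k) (a : Fin (e + 1) → MvPowerSeries (Fin m) k)
    {j : Fin (e + 1)} (hj : (a j).order < (TupleGame.marking e j : ℕ∞)) :
    (TupleGame.germ U a).order < ((e + 2 : ℕ) : ℕ∞) := by
  have ha : a j ≠ 0 := by
    rintro h
    rw [h, order_zero] at hj
    exact not_top_lt hj
  obtain ⟨β, hβ, hdeg⟩ := exists_coeff_ne_zero_and_order (ne_zero_iff_order_finite.mp ha)
  have hlt : β.degree < TupleGame.marking e j := by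
    rw [← hdeg] at hj
    exact_mod_cast hj
  have hle := order_le (f := TupleGame.germ U a)
    (d := Finsupp.embDomain (Fin.succAboveEmb (Fin.last m)) β + Finsupp.single (Fin.last m) (j : ℕ))
    (by rw [coeff_germ]; exact hβ)
  rw [TschirnhausForm.degree_emb_add_single] at hle
  refine lt_of_le_of_lt hle ?_
  have := TupleGame.marking_add_val e j
  exact_mod_cast (by omega : β.degree + (j : ℕ) < e + 2)

end MultiplicityLift

/-- Registered sub-goal `stub_multiplicityLiftGermOrder` of `stub_multiplicityLift` (every field): A PREPARED GERM WITH A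
NON-BAD ENTRY HAS SMALL ORDER.  If some entry `a_j` of the coefficient tuple has order `< marking e j = e + 2 - j`, then
the prepared germ `TupleGame.germ U a = U · y^{e+2} + Σ_j a_j(x') y^j` has order `< e + 2` (its coefficient at
`x'^β y^j` is `coeff β a_j`, `MultiplicityLift.coeff_germ`). -/
theorem stub_multiplicityLiftGermOrder : ∀ (k : Type) [Field k] (m e : ℕ) (U : MvPowerSeries (Fin (m + 1)) k)
    (a : Fin (e + 1) → MvPowerSeries (Fin m) k) (j : Fin (e + 1)),
    (a j).order < ((TupleGame.marking e j : ℕ) : ℕ∞) → (TupleGame.germ U a).order < ((e + 2 : ℕ) : ℕ∞) := by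
  intro k _ m e U a j hj
  exact MultiplicityLift.germ_order_lt U a hj

end Summit.ResolutionOfSingularities.ResolutionOfSingularities.Theorems
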